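import Summits.Ventures.CertifiedQuantumChemistry.Rows.SubsystemSectorRows
import Literature.MathematicalPhysics.QuantumChemistry.DualConeFamilySum
import HarnessLib

/-!
# Ventures/CertifiedQuantumChemistry — Rows/DualConePairLowerRows.lean: lower rows from a dual-cone
# certificate over SEVERAL condition families (slack form; base programme ⊕ subsystem blocks)

HONEST FRAMING (verbatim): certified bounds for a stated model Hamiltonian in a stated basis; not a claim
about the real molecule or material beyond that model.

LADDER-CHEM I-TYPE slot 07 (cell chem-oracle, seat chem-type-07 gen 4; zero compute; PROVED glue, 0 sorry,
0 def; nothing asserted about any pinned file). Row-level companions of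
`Literature/MathematicalPhysics/QuantumChemistry/DualConeFamilySum.lean`, closing the plumbing gap named by
chem-type-02 (`Rows/SubsystemRows.lean` module docstring: "combine with the base programme's family on the
disjoint union of the index types"): `lowerRow_of_dualCone_certificate` (`Rows/DualConeLowerRow.lean`) takes
ONE positivity family with ONE dependent block-type family `X c`; an exact certificate of a relaxation
«base programme (P, Q, G, T1, …) + certified subsystem rows (`1 × 1` blocks)» has TWO families with different
block index types. Here:
* `lowerRow_of_slack_certificate` / `singletLowerRow_of_slack_certificate` — any slack `S` with `0 ≤ Re S`
  on the feasible pairs (several families and scalar rows enter one identity; slacks add);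
* `lowerRow_of_dualCone_pairCertificate` / `singletLowerRow_of_dualCone_pairCertificate` — two families,
  `E_F − μ = Σ_c tr(B¹_c 𝓛¹_c) + Σ_d tr(B²_d 𝓛²_d) + Σ_r λ_r (A_r − b_r)` (CSL eq. (8), list split in two);
* the instances type-02 / type-10 asked for: base family `𝓛` (necessary in the sector) ⊕ the `1 × 1`
  blocks of certified subsystem rows (`subsystemBlock`, multipliers `ν_i ⪰ 0` as `1 × 1` matrices, i.e.
  `ν_i ≥ 0` via `posSemidef_diagonal_iff`) — `lowerRow_of_dualCone_certificate_subsystemBlocks` — and ⊕ the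
  sector-resolved subsystem blocks (`subsystemSectorBlock`) — `lowerRow_of_dualCone_certificate_subsystemSectorBlocks`.
All are one-line compositions of the Literature theorems with `lowerRow`'s definition; the flip-quotient
route has no operator-identity certificate at this level (its rows are read through `FlipLowerNode`).
-/

namespace Summit.Ventures.CertifiedQuantumChemistry

open Matrix Finset
open Literature.MathematicalPhysics.QuantumLattice Literature.MathematicalPhysics.QuantumChemistry
open scoped ComplexOrder

variable {k : ℕ}

/-! ## §1 Slack form -/

/-- **SLACK CERTIFICATE ⇒ LOWER ROW.** Symmetric model `F`, `a, b ≤ k`; a feasibility predicate `P` and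
equality rows `A_r = b_r` necessary in the sector `(a, b)`; a slack functional `S` with `0 ≤ Re S` on the
`P`-feasible pairs; free multipliers `λ_r`, a real `μ` with `E_F(γ, Γ) − μ = S(γ, Γ) + Σ_r λ_r (A_r(γ, Γ) − b_r)`
for ALL pairs, and a rational `lo ≤ μ`: `LowerRow F a b lo` (`le_sectorGroundEnergy_of_slack_certificate`).
[cite: CancesStoltzLewin2006, §3 eqs. (8)-(10)] -/
theorem lowerRow_of_slack_certificate {F : Model k} (hF : F.IsSymmetric) {a b : ℕ} (ha : a ≤ k)
    (hb : b ≤ k)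
    (P : Matrix (Orb (Fin k)) (Orb (Fin k)) ℂ →
      Matrix (Orb (Fin k) × Orb (Fin k)) (Orb (Fin k) × Orb (Fin k)) ℂ → Prop)
    (hPn : IsNecessaryInSector a b P)
    (S : Matrix (Orb (Fin k)) (Orb (Fin k)) ℂ →
      Matrix (Orb (Fin k) × Orb (Fin k)) (Orb (Fin k) × Orb (Fin k)) ℂ → ℂ)
    (hS : ∀ γ Γ, P γ Γ → 0 ≤ (S γ Γ).re) {ρ : Type*} [Fintype ρ]
    (A : ρ → Matrix (Orb (Fin k)) (Orb (Fin k)) ℂ →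
      Matrix (Orb (Fin k) × Orb (Fin k)) (Orb (Fin k) × Orb (Fin k)) ℂ → ℂ) (rhs : ρ → ℂ)
    (hArows : IsNecessaryInSector a b fun γ Γ => ∀ r, A r γ Γ = rhs r) (lam : ρ → ℂ) {μ : ℝ}
    (hcert : ∀ γ Γ,
      rdmEnergy (fun p q => (F.h p q : ℂ)) (fun p q r s => (F.eri p q r s : ℂ)) (F.ecore : ℂ) γ Γ -
          (μ : ℂ) = S γ Γ + ∑ r, lam r * (A r γ Γ - rhs r))
    {lo : ℚ} (hlo : ((lo : ℚ) : ℝ) ≤ μ) : LowerRow F a b lo :=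
  ⟨ha, hb, hlo.trans (le_sectorGroundEnergy_of_slack_certificate (Model.hamiltonian_isHermitian hF)
    (by simpa using ha) (by simpa using hb) P hPn S hS A rhs hArows lam hcert)⟩

/-- **SLACK CERTIFICATE ⇒ SINGLET LOWER ROW** (`s2=0` instances): `P` and the rows necessary for the singlet
class of `(n, n)`, `n ≤ k`, the same identity, `lo ≤ μ`: `SingletLowerRow F n lo`
(`le_minEnergyOn_spinClass_of_slack_certificate`). [cite: CancesStoltzLewin2006, §3 eqs. (8)-(10)] -/
theorem singletLowerRow_of_slack_certificate {F : Model k} {n : ℕ} (hn : n ≤ k)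
    (P : Matrix (Orb (Fin k)) (Orb (Fin k)) ℂ →
      Matrix (Orb (Fin k) × Orb (Fin k)) (Orb (Fin k) × Orb (Fin k)) ℂ → Prop)
    (hPn : IsNecessaryInSpinClass n n P)
    (S : Matrix (Orb (Fin k)) (Orb (Fin k)) ℂ →
      Matrix (Orb (Fin k) × Orb (Fin k)) (Orb (Fin k) × Orb (Fin k)) ℂ → ℂ)
    (hS : ∀ γ Γ, P γ Γ → 0 ≤ (S γ Γ).re) {ρ : Type*} [Fintype ρ]
    (A : ρ → Matrix (Orb (Fin k)) (Orb (Fin k)) ℂ →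
      Matrix (Orb (Fin k) × Orb (Fin k)) (Orb (Fin k) × Orb (Fin k)) ℂ → ℂ) (rhs : ρ → ℂ)
    (hArows : IsNecessaryInSpinClass n n fun γ Γ => ∀ r, A r γ Γ = rhs r) (lam : ρ → ℂ) {μ : ℝ}
    (hcert : ∀ γ Γ,
      rdmEnergy (fun p q => (F.h p q : ℂ)) (fun p q r s => (F.eri p q r s : ℂ)) (F.ecore : ℂ) γ Γ -
          (μ : ℂ) = S γ Γ + ∑ r, lam r * (A r γ Γ - rhs r))
    {lo : ℚ} (hlo : ((lo : ℚ) : ℝ) ≤ μ) : SingletLowerRow F n lo :=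
  ⟨hn, hlo.trans (le_minEnergyOn_spinClass_of_slack_certificate _ _ _ le_rfl (by simpa using hn) P hPn S
    hS A rhs hArows lam hcert)⟩

/-! ## §2 Two positivity families -/

section TwoFamilies

variable {κ₁ : Type*} [Fintype κ₁] {X₁ : κ₁ → Type*} [∀ c, Fintype (X₁ c)] [∀ c, DecidableEq (X₁ c)]
variable {κ₂ : Type*} [Fintype κ₂] {X₂ : κ₂ → Type*} [∀ c, Fintype (X₂ c)] [∀ c, DecidableEq (X₂ c)]

/-- **TWO-FAMILY DUAL-CONE CERTIFICATE ⇒ LOWER ROW.** Symmetric `F`, `a, b ≤ k`; positivity families `𝓛¹`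
(block types `X₁ c`) and `𝓛²` (block types `X₂ d`) and equality rows, all necessary in the sector `(a, b)`;
multipliers `B¹_c, B²_d ⪰ 0`, `λ_r`, a real `μ` with
`E_F(γ, Γ) − μ = Σ_c tr(B¹_c 𝓛¹_c(γ, Γ)) + Σ_d tr(B²_d 𝓛²_d(γ, Γ)) + Σ_r λ_r (A_r(γ, Γ) − b_r)` for ALL pairs, and
`lo ≤ μ`: `LowerRow F a b lo` — CSL eq. (8) for the concatenated condition list
(`le_sectorGroundEnergy_of_dualCone_pairCertificate`). [cite: CancesStoltzLewin2006, §3 eqs. (8)-(10)] -/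
theorem lowerRow_of_dualCone_pairCertificate {F : Model k} (hF : F.IsSymmetric) {a b : ℕ} (ha : a ≤ k)
    (hb : b ≤ k)
    (L₁ : ∀ c : κ₁, Matrix (Orb (Fin k)) (Orb (Fin k)) ℂ →
      Matrix (Orb (Fin k) × Orb (Fin k)) (Orb (Fin k) × Orb (Fin k)) ℂ → Matrix (X₁ c) (X₁ c) ℂ)
    (hL₁ : IsNecessaryInSector a b (PosMapFeasible L₁))
    (L₂ : ∀ c : κ₂, Matrix (Orb (Fin k)) (Orb (Fin k)) ℂ →
      Matrix (Orb (Fin k) × Orb (Fin k)) (Orb (Fin k) × Orb (Fin k)) ℂ → Matrix (X₂ c) (X₂ c) ℂ)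
    (hL₂ : IsNecessaryInSector a b (PosMapFeasible L₂)) {ρ : Type*} [Fintype ρ]
    (A : ρ → Matrix (Orb (Fin k)) (Orb (Fin k)) ℂ →
      Matrix (Orb (Fin k) × Orb (Fin k)) (Orb (Fin k) × Orb (Fin k)) ℂ → ℂ) (rhs : ρ → ℂ)
    (hArows : IsNecessaryInSector a b fun γ Γ => ∀ r, A r γ Γ = rhs r)
    {B₁ : ∀ c : κ₁, Matrix (X₁ c) (X₁ c) ℂ} (hB₁ : ∀ c, (B₁ c).PosSemidef)
    {B₂ : ∀ c : κ₂, Matrix (X₂ c) (X₂ c) ℂ} (hB₂ : ∀ c, (B₂ c).PosSemidef) (lam : ρ → ℂ) {μ : ℝ}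
    (hcert : ∀ γ Γ,
      rdmEnergy (fun p q => (F.h p q : ℂ)) (fun p q r s => (F.eri p q r s : ℂ)) (F.ecore : ℂ) γ Γ -
          (μ : ℂ) =
        ∑ c, (B₁ c * L₁ c γ Γ).trace + ∑ c, (B₂ c * L₂ c γ Γ).trace + ∑ r, lam r * (A r γ Γ - rhs r))
    {lo : ℚ} (hlo : ((lo : ℚ) : ℝ) ≤ μ) : LowerRow F a b lo :=
  ⟨ha, hb, hlo.trans (le_sectorGroundEnergy_of_dualCone_pairCertificate (Model.hamiltonian_isHermitian hF)
    (by simpa using ha) (by simpa using hb) L₁ hL₁ L₂ hL₂ A rhs hArows hB₁ hB₂ lam hcert)⟩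

/-- **TWO-FAMILY DUAL-CONE CERTIFICATE ⇒ SINGLET LOWER ROW** (both families and the rows necessary for the
singlet class of `(n, n)`, `n ≤ k`, `lo ≤ μ`): `SingletLowerRow F n lo`
(`le_minEnergyOn_spinClass_of_dualCone_pairCertificate`). [cite: CancesStoltzLewin2006, §3 eqs. (8)-(10)] -/
theorem singletLowerRow_of_dualCone_pairCertificate {F : Model k} {n : ℕ} (hn : n ≤ k)
    (L₁ : ∀ c : κ₁, Matrix (Orb (Fin k)) (Orb (Fin k)) ℂ →
      Matrix (Orb (Fin k) × Orb (Fin k)) (Orb (Fin k) × Orb (Fin k)) ℂ → Matrix (X₁ c) (X₁ c) ℂ)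
    (hL₁ : IsNecessaryInSpinClass n n (PosMapFeasible L₁))
    (L₂ : ∀ c : κ₂, Matrix (Orb (Fin k)) (Orb (Fin k)) ℂ →
      Matrix (Orb (Fin k) × Orb (Fin k)) (Orb (Fin k) × Orb (Fin k)) ℂ → Matrix (X₂ c) (X₂ c) ℂ)
    (hL₂ : IsNecessaryInSpinClass n n (PosMapFeasible L₂)) {ρ : Type*} [Fintype ρ]
    (A : ρ → Matrix (Orb (Fin k)) (Orb (Fin k)) ℂ →
      Matrix (Orb (Fin k) × Orb (Fin k)) (Orb (Fin k) × Orb (Fin k)) ℂ → ℂ) (rhs : ρ → ℂ)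
    (hArows : IsNecessaryInSpinClass n n fun γ Γ => ∀ r, A r γ Γ = rhs r)
    {B₁ : ∀ c : κ₁, Matrix (X₁ c) (X₁ c) ℂ} (hB₁ : ∀ c, (B₁ c).PosSemidef)
    {B₂ : ∀ c : κ₂, Matrix (X₂ c) (X₂ c) ℂ} (hB₂ : ∀ c, (B₂ c).PosSemidef) (lam : ρ → ℂ) {μ : ℝ}
    (hcert : ∀ γ Γ,
      rdmEnergy (fun p q => (F.h p q : ℂ)) (fun p q r s => (F.eri p q r s : ℂ)) (F.ecore : ℂ) γ Γ -
          (μ : ℂ) =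
        ∑ c, (B₁ c * L₁ c γ Γ).trace + ∑ c, (B₂ c * L₂ c γ Γ).trace + ∑ r, lam r * (A r γ Γ - rhs r))
    {lo : ℚ} (hlo : ((lo : ℚ) : ℝ) ≤ μ) : SingletLowerRow F n lo :=
  ⟨hn, hlo.trans (le_minEnergyOn_spinClass_of_dualCone_pairCertificate _ _ _ le_rfl (by simpa using hn)
    L₁ hL₁ L₂ hL₂ A rhs hArows hB₁ hB₂ lam hcert)⟩

end TwoFamilies

/-! ## §3 Base programme ⊕ certified subsystem rows (the instances of record) -/

section Subsystem

variable {κ : Type*} [Fintype κ] {X : κ → Type*} [∀ c, Fintype (X c)] [∀ c, DecidableEq (X c)]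

/-- **BASE FAMILY ⊕ SUBSYSTEM ROWS ⇒ LOWER ROW.** Symmetric `F`, `a, b ≤ k`; a positivity family `𝓛`
necessary in the sector (the base programme's blocks); fragments `FA i` embedded by `e i` with CERTIFIED
energy floors `Lf i` and affine minorants `(α i, β i)` (`Rows/SubsystemRows.lean`: each subsystem row is then
a necessary `1 × 1` block `subsystemBlock`); equality rows necessary in the sector; multipliers `B_c ⪰ 0`,
`ν_i ⪰ 0` (`1 × 1`), `λ_r`, a real `μ` with `E_F − μ = Σ_c tr(B_c 𝓛_c) + Σ_i tr(ν_i · subsystemBlock_i) +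
Σ_r λ_r (A_r − b_r)` for ALL pairs, `lo ≤ μ`: `LowerRow F a b lo`. [cite: CancesStoltzLewin2006, §3 eqs. (7)-(10)] -/
theorem lowerRow_of_dualCone_certificate_subsystemBlocks {F : Model k} (hF : F.IsSymmetric) {a b : ℕ}
    (ha : a ≤ k) (hb : b ≤ k)
    (L : ∀ c : κ, Matrix (Orb (Fin k)) (Orb (Fin k)) ℂ →
      Matrix (Orb (Fin k) × Orb (Fin k)) (Orb (Fin k) × Orb (Fin k)) ℂ → Matrix (X c) (X c) ℂ)
    (hL : IsNecessaryInSector a b (PosMapFeasible L))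
    {ι' : Type*} [Fintype ι'] {kA : ι' → ℕ} (FA : ∀ i, Model (kA i))
    (e : ∀ i, Orb (Fin (kA i)) ↪o Orb (Fin k)) {Lf : ι' → ℕ → ℚ} {α β : ι' → ℚ}
    (hLf : ∀ i, FragmentEnergyFloor (FA i) (Lf i)) (hmin : ∀ i, IsAffineMinorant (kA i) (Lf i) (α i) (β i))
    {ρ : Type*} [Fintype ρ]
    (A : ρ → Matrix (Orb (Fin k)) (Orb (Fin k)) ℂ →
      Matrix (Orb (Fin k) × Orb (Fin k)) (Orb (Fin k) × Orb (Fin k)) ℂ → ℂ) (rhs : ρ → ℂ)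
    (hArows : IsNecessaryInSector a b fun γ Γ => ∀ r, A r γ Γ = rhs r)
    {B : ∀ c : κ, Matrix (X c) (X c) ℂ} (hB : ∀ c, (B c).PosSemidef)
    {ν : ι' → Matrix Unit Unit ℂ} (hν : ∀ i, (ν i).PosSemidef) (lam : ρ → ℂ) {μ : ℝ}
    (hcert : ∀ γ Γ,
      rdmEnergy (fun p q => (F.h p q : ℂ)) (fun p q r s => (F.eri p q r s : ℂ)) (F.ecore : ℂ) γ Γ -
          (μ : ℂ) =
        ∑ c, (B c * L c γ Γ).trace + ∑ i, (ν i * subsystemBlock (FA i) (e i) (α i) (β i) γ Γ).trace +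
          ∑ r, lam r * (A r γ Γ - rhs r))
    {lo : ℚ} (hlo : ((lo : ℚ) : ℝ) ≤ μ) : LowerRow F a b lo :=
  lowerRow_of_dualCone_pairCertificate hF ha hb L hL (fun i => subsystemBlock (FA i) (e i) (α i) (β i))
    (isNecessaryInSector_posMapFeasible_subsystemBlocks FA e hLf hmin a b) A rhs hArows hB hν lam hcert hlo

/-- **BASE FAMILY ⊕ SECTOR-RESOLVED SUBSYSTEM ROWS ⇒ LOWER ROW**: the same with the two-price sector blocks
`subsystemSectorBlock` of `Rows/SubsystemSectorRows.lean` (symmetric fragments `FA i` embedded by `φ i`,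
certified SECTOR floors `Lf i a b` and two-price minorants `(m i, μa i, μb i)`).
[cite: CancesStoltzLewin2006, §3 eqs. (7)-(10)] -/
theorem lowerRow_of_dualCone_certificate_subsystemSectorBlocks {F : Model k} (hF : F.IsSymmetric)
    {a b : ℕ} (ha : a ≤ k) (hb : b ≤ k)
    (L : ∀ c : κ, Matrix (Orb (Fin k)) (Orb (Fin k)) ℂ →
      Matrix (Orb (Fin k) × Orb (Fin k)) (Orb (Fin k) × Orb (Fin k)) ℂ → Matrix (X c) (X c) ℂ)
    (hL : IsNecessaryInSector a b (PosMapFeasible L))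
    {ι' : Type*} [Fintype ι'] {kA : ι' → ℕ} (FA : ∀ i, Model (kA i)) (hFA : ∀ i, (FA i).IsSymmetric)
    (φ : ∀ i, Fin (kA i) ↪o Fin k) {Lf : ι' → ℕ → ℕ → ℚ} {m μa μb : ι' → ℚ}
    (hLf : ∀ i, FragmentSectorFloor (FA i) (Lf i))
    (hmin : ∀ i, IsTwoPriceMinorant (kA i) (Lf i) (m i) (μa i) (μb i)) {ρ : Type*} [Fintype ρ]
    (A : ρ → Matrix (Orb (Fin k)) (Orb (Fin k)) ℂ →
      Matrix (Orb (Fin k) × Orb (Fin k)) (Orb (Fin k) × Orb (Fin k)) ℂ → ℂ) (rhs : ρ → ℂ)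
    (hArows : IsNecessaryInSector a b fun γ Γ => ∀ r, A r γ Γ = rhs r)
    {B : ∀ c : κ, Matrix (X c) (X c) ℂ} (hB : ∀ c, (B c).PosSemidef)
    {ν : ι' → Matrix Unit Unit ℂ} (hν : ∀ i, (ν i).PosSemidef) (lam : ρ → ℂ) {μ : ℝ}
    (hcert : ∀ γ Γ,
      rdmEnergy (fun p q => (F.h p q : ℂ)) (fun p q r s => (F.eri p q r s : ℂ)) (F.ecore : ℂ) γ Γ -
          (μ : ℂ) =
        ∑ c, (B c * L c γ Γ).trace +
            ∑ i, (ν i * subsystemSectorBlock (FA i) (φ i) (m i) (μa i) (μb i) γ Γ).trace +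
          ∑ r, lam r * (A r γ Γ - rhs r))
    {lo : ℚ} (hlo : ((lo : ℚ) : ℝ) ≤ μ) : LowerRow F a b lo :=
  lowerRow_of_dualCone_pairCertificate hF ha hb L hL
    (fun i => subsystemSectorBlock (FA i) (φ i) (m i) (μa i) (μb i))
    (isNecessaryInSector_posMapFeasible_subsystemSectorBlocks FA hFA φ hLf hmin a b) A rhs hArows hB hν
    lam hcert hlo

end Subsystem

end Summit.Ventures.CertifiedQuantumChemistry
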